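import Summits.BirchSwinnertonDyer.Rank1Residual.Supersingular.KobayashiMainConjectureX7FouquetWan
import Summits.BirchSwinnertonDyer.Rank1Residual.Supersingular.KobayashiMainConjectureX7
import Literature.NumberTheory.EllipticCurves.Rank1Residual.X9NoEntry
import Literature.NumberTheory.EllipticCurves.Kato2004.Condition1252
import HarnessLib

/-!
# Route `SignedLowerHalves`, crux `KobayashiMainConjectureSmallImage` (item stmt-BirchSwinnertonDyer-19002):
# NO printed or announced engine reaches the small-image branch of corner X7 — kernel obstructions
# (cell `bsd-ssimc`, seat `bsd-ssimc-k3-c4` gen 0; a `--supports … --as helper` file, closes nothing)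

PARTITION (cell bsd-ssimc): X7 (A7) × the pairs with `ρ̄_{E,p}` NOT surjective (`a_p = 0`, odd good
supersingular `p`; window of record TARGET §6.0b/§6.5: 34–35 rank-0 pairs at `p ≥ 5`, 96 at `p = 3`,
plus the rank-1 ones) — types-the-object-of (what the crux is NOT reachable by); closes NONE.
THEOREMS ONLY; nothing about any curve is asserted; nothing booked.

## What this file records

The crux (`Theses/SignedLowerHalves.lean`, rank 4) asks, for every non-semistable non-CM `E/ℚ` and
odd good supersingular `p` with `a_p = 0` and `ρ̄_{E,p}` NOT surjective, for a sign `ε` with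
Kobayashi's signed main conjecture as an EQUALITY (`KobayashiMainConjecture W p ε`). The director's
question for this seat (D-0074, REQUESTS l.472–486): «FW21 Cor 5.4 OPEN fact p412876 route: what
survives without large image». Answer, as kernel theorems over facts ALREADY in the tree (Serre 1972
Prop. 15 + Tate-curve inertia: `surj_of_irr_of_ram`; the transvection criterion:
`not_bigIm_of_irr_of_not_surj`; Serre Prop. 21 i): `ClassX6.surj`; Silverman X.5:
`twistAdmissible_hasSurjectiveModNGaloisRep_smul_quadraticTwist`; `E[p]` irreducible at a good
supersingular odd `p`: `ClassX7.irr`): on the domain of the crux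

* `smallImage_not_ram` — there is NO multiplicative prime `ℓ ≠ p` with `p ∤ v_ℓ(Δ_min)` (¬ram);
* `smallImage_not_fwLocus` — hence the locus hypothesis shared by BOTH Fouquet–Wan binders of the
  tree (`Summit.….Supersingular.FouquetWan2021_thm51_via_kobayashi74_OPEN`, p414007, and
  `Literature.….FouquetWan2021.cor54_pPart_rankZero_OPEN`, p412876: «∃ ℓ ≠ p non-split
  multiplicative, p ∤ v_ℓ(Δ_min)») is UNSATISFIABLE: NOTHING of the Fouquet–Wan road survives at
  small image, and the «small-image twin of p414676» suggested in the D-0074 fragment would be a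
  theorem with contradictory hypotheses (so it is not filed);
* `smallImage_not_bigIm`, `smallImage_not_imageContainsSL2`, `smallImage_not_towerSurj` — the
  image hypotheses of every integral Euler/Kolyvagin-system input in the tree fail: BCS 2025 (im) =
  `BigIm`, Kato 2004 (12.5.2) = `Kato2004.ImageContainsSL2` (Thm. 17.4 (3); Kobayashi Thm. 4.1's
  INTEGRAL clause), Kim 2022/2025's tower surjectivity `∀ n, ρ̄_{E,p^n}` onto
  (`Kim2025.…_of_towerSurj_OPEN`), and plain `Surj` (Zhang 2014 / the toric avatar
  `X7.ToricPeriodUnitAt` road / Wuthrich 2014 Prop. 21 at an irreducible prime);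
* `smallImage_not_semistable_twist` — the curve is NOT a quadratic twist of a semistable curve
  `W₀` with `p` good supersingular and (`p = 3 → a_3(W₀) = 0`): so BSTW arXiv:2409.01350 Thm. 1.3
  (needs `Semistable`, excluded by `ClassX7` itself) AND its TWIST CLAUSE
  (`BurungaleSkinnerTianWan2024_thm13_twist_OPEN`, whose conclusion is about such twists) never
  speak about an item-4 curve; likewise CCSS arXiv:1804.10993 Thm. C/D (`thmCD_pPart_OPEN`, needs
  `Semistable`);
* `smallImage_not_dvd_card_image` — positively, what the class IS: `p ∤ #ρ̄_{E,p}(Γ_ℚ)` (an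
  irreducible image of order prime to `p`; with `ρ̄(I_p)` cyclic of order `p² − 1` at a supersingular
  `p` this is the normaliser-of-non-split-Cartan locus `X_ns^+(p)` — prose, the tree has no
  predicate for it).

What is NOT here: any claim about the crux itself (OPEN: no engine); the rank-0 reading of the
saturation stub (sequel file `…SmallImageSaturationRankZero.lean`); anything booked.

References: [Serre1972] §2.4 Prop. 15, §5.4 Prop. 21 i), §1.11 Prop. 12; [Kato2004] (12.5.2),
Thm. 17.4; [BurungaleCastellaSkinner2025] (im); [FouquetWan2021] Thm. 5.1 / Cor. 5.4 (PRE);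
[BurungaleSkinnerTianWan2024] Thm. 1.3 (PRE); [Kobayashi2003] Thm. 4.1, Thm. 7.4;
[SilvermanAEC2009] X.5 Cor. 5.4.
-/

set_option autoImplicit false
set_option linter.dupNamespace false

noncomputable section

open scoped Classical

open WeierstrassCurve Literature.NumberTheory.EllipticCurves
  Literature.NumberTheory.EllipticCurves.Rank1Residual
  Summit.BirchSwinnertonDyer.Rank1Residual.Supersingular

namespace Summit.BirchSwinnertonDyer.BirchSwinnertonDyer.Theorems

variable (W : WeierstrassCurve ℚ) [W.IsElliptic] [W.IsGloballyMinimal] (p : ℕ) [Fact p.Prime]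

/-! ### (ram) and the Fouquet–Wan locus -/

/-- **On the small-image branch of corner X7 there is no ramified multiplicative prime.** For an X7
pair at an odd prime with `ρ̄_{E,p}` not surjective, `¬ Ram W p`: every multiplicative `ℓ ≠ p` has
`p ∣ v_ℓ(Δ_min)` — `E[p]` is irreducible (`ClassX7.irr`, Serre Prop. 12) and irr ∧ ram ⟹ surj
(`surj_of_irr_of_ram`: Tate-curve inertia gives a transvection, Serre Prop. 15).
[cite: Serre1972, §2.4 Prop. 15 and §1.11 Prop. 12] -/
theorem smallImage_not_ram (hp : p ≠ 2) (hX : ClassX7 W p) (hs : ¬ Surj W p) : ¬ Ram W p :=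
  not_ram_of_irr_of_not_surj W p (ClassX7.irr W p hp hX) hs

/-- **The Fouquet–Wan locus is EMPTY at small image.** On an X7 pair at an odd prime with
`ρ̄_{E,p}` not surjective there is NO prime `ℓ ≠ p` of non-split multiplicative reduction with
`p ∤ v_ℓ(Δ_min)` — the locus hypothesis, verbatim, of BOTH OPEN Fouquet–Wan binders of the tree
(`FouquetWan2021_thm51_via_kobayashi74_OPEN`, `FouquetWan2021.cor54_pPart_rankZero_OPEN`). So the
Fouquet–Wan road (arXiv:2107.13726 Thm. 5.1 / Cor. 5.4, PRE) reaches NO pair of crux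
`KobayashiMainConjectureSmallImage`, whatever its refereeing status. [cite: Serre1972, §2.4 Prop. 15] -/
theorem smallImage_not_fwLocus (hp : p ≠ 2) (hX : ClassX7 W p) (hs : ¬ Surj W p) :
    ¬ ∃ (ℓ : ℕ) (_ : Fact ℓ.Prime), ℓ ≠ p ∧ W.HasMultiplicativeReductionAtPrime ℓ ∧
        ¬ W.HasSplitMultiplicativeReductionAtPrime ℓ ∧ ¬ p ∣ padicValInt ℓ W.minimalDiscriminantInt := by
  rintro ⟨ℓ, hℓ, hℓp, hmult, -, hdiv⟩
  exact smallImage_not_ram W p hp hX hs ⟨ℓ, hℓ, hℓp, hmult, hdiv⟩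

/-- **The crux's domain, verbatim, meets the Fouquet–Wan locus in the empty set** (the binders
`¬CM`, `a_p = 0` of the route decl carried unused): for every `W, p` as in
`Theses.SignedLowerHalves.KobayashiMainConjectureSmallImage`, the locus clause of
`FouquetWan2021_thm51_via_kobayashi74_OPEN` fails. [cite: Serre1972, §2.4 Prop. 15] -/
theorem smallImage_not_fwLocus' :
    ∀ (W : WeierstrassCurve ℚ) [W.IsElliptic] [W.IsGloballyMinimal] (p : ℕ) [Fact p.Prime],
      p ≠ 2 → ClassX7 W p → ¬ W.HasCM → W.frobeniusTrace p = 0 → ¬ Surj W p →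
      ¬ ∃ (ℓ : ℕ) (_ : Fact ℓ.Prime), ℓ ≠ p ∧ W.HasMultiplicativeReductionAtPrime ℓ ∧
        ¬ W.HasSplitMultiplicativeReductionAtPrime ℓ ∧ ¬ p ∣ padicValInt ℓ W.minimalDiscriminantInt :=
  fun W _ _ p _ hp hX _ _ hs ↦ smallImage_not_fwLocus W p hp hX hs

/-! ### The image hypotheses of the integral Euler-system inputs -/

/-- **BCS's (im) fails at small image**: no `σ ∈ G_{ℚ(μ_{p^∞})}` has `T_pE/(σ−1)T_pE ≅ ℤ_p`
(`BigIm`; = Kato 2004 Thm. 13.4 (3)'s hypothesis, Skinner 2016 §2.5 (b)). [cite: BurungaleCastellaSkinner2025, p. 2, hypothesis (im)]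
[cite: Serre1972, §2.4 Prop. 15] -/
theorem smallImage_not_bigIm (hp : p ≠ 2) (hX : ClassX7 W p) (hs : ¬ Surj W p) : ¬ BigIm W p :=
  not_bigIm_of_irr_of_not_surj W p (ClassX7.irr W p hp hX) hs

omit [W.IsGloballyMinimal] in
/-- **Kato's (12.5.2) fails at small image**: the image of `Gal(ℚ̄/ℚ(ζ_{p^∞}))` in `GL(T_pE)` does
not contain `SL₂(ℤ_p)` — the hypothesis under which Kato's Thm. 17.4 (3), hence Kobayashi 2003
Thm. 4.1, is INTEGRAL; only the rational clause (`pⁿ·L_p^ε ∈ char X^ε`) survives.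
[cite: Kato2004Asterisque, (12.5.2) in Thm. 12.5 (4) (p. 222) and Thm. 17.4] -/
theorem smallImage_not_imageContainsSL2 (hs : ¬ Surj W p) : ¬ Kato2004.ImageContainsSL2 W p :=
  fun h ↦ hs (Kato2004.hasSurjectiveModNGaloisRep_of_imageContainsSL2 W p h)

omit [W.IsElliptic] [W.IsGloballyMinimal] in
/-- **Kim's tower surjectivity fails at small image**: `ρ̄_{E,p^n}` is not onto for all `n` (the
hypothesis of `Kim2025.rankZero_padicValNat_sha_le_of_towerSurj_OPEN` and its companions; the
published `p ≥ 5` Kim 2022/2026 facts want `ρ̄_{E,p}` onto outright). [folklore] -/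
theorem smallImage_not_towerSurj (hs : ¬ Surj W p) :
    ¬ ∀ n : ℕ, W.HasSurjectiveModNGaloisRep (p ^ n : ℕ) :=
  fun h ↦ hs (by simpa only [pow_one] using h 1)

/-! ### BSTW's twist clause -/

/-- **An item-4 curve is not a quadratic twist of a BSTW base curve.** If `Wd` (any model) is
`C • W₀^{(d)}` with `W₀` globally minimal, `Semistable W₀`, `GoodSS W₀ p`, `p` odd and
(`p = 3 → a_3(W₀) = 0`) — the standing hypotheses of BSTW Thm. 1.3 and of the base curve in its
twist clause `BurungaleSkinnerTianWan2024_thm13_twist_OPEN` — then `ρ̄_{Wd,p}` is onto: `W₀` is an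
X6 pair, so `ρ̄_{W₀,p}` is onto (Serre Prop. 21 i), `ClassX6.surj`), and surjectivity passes to
quadratic twists (`ρ̄_{E^d} ≅ ρ̄_E ⊗ χ_d`). Hence at `¬ Surj Wd p` no such `(W₀, d, C)` exists: the
twist clause never concludes anything about a small-image pair. [cite: Serre1972, §5.4 Prop. 21 i)]
[cite: SilvermanAEC2009, X.5 Cor. 5.4 and X.2 Prop. 2.4] -/
theorem smallImage_not_semistable_twist (Wd : WeierstrassCurve ℚ) [Wd.IsElliptic] (hp : p ≠ 2)
    (hs : ¬ Surj Wd p) :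
    ¬ ∃ (W₀ : WeierstrassCurve ℚ) (_ : W₀.IsElliptic) (_ : W₀.IsGloballyMinimal) (d : ℚ)
        (C : VariableChange ℚ), d ≠ 0 ∧ Semistable W₀ ∧ GoodSS W₀ p ∧
        (p = 3 → W₀.frobeniusTrace 3 = 0) ∧ C • W₀.quadraticTwist d = Wd := by
  rintro ⟨W₀, _, _, d, C, hd, hsst, hss, h4, hC⟩
  have hX6 : ClassX6 W₀ p := by
    refine ⟨hss, hsst, ?_⟩
    by_cases hp3 : p = 3
    · exact Or.inr (h4 hp3)
    · exact Or.inl ((Fact.out : p.Prime).five_le_of_ne_two_of_ne_three hp hp3)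
  have hsW : Surj W₀ p := ClassX6.surj W₀ p hp hX6
  apply hs
  rw [← hC]
  exact twistAdmissible_hasSurjectiveModNGaloisRep_smul_quadraticTwist W₀ hd C p hsW

/-- **The BSTW twist clause's instantiation data cannot exist at small image** — the same statement
with the clause's own field-theoretic side conditions displayed (`K` quadratic, `d = d_K` coprime to
`N·p`, every `ℓ ∣ d_K` good ordinary for `W₀`), all carried unused: only `Semistable W₀`,
`GoodSS W₀ p`, (h4) and the twist relation matter. [cite: Serre1972, §5.4 Prop. 21 i)]
[cite: SilvermanAEC2009, X.5 Cor. 5.4 and X.2 Prop. 2.4] -/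
theorem smallImage_not_BSTW13_twist_data (Wd : WeierstrassCurve ℚ) [Wd.IsElliptic] (hp : p ≠ 2)
    (hs : ¬ Surj Wd p) :
    ¬ ∃ (W₀ : WeierstrassCurve ℚ) (_ : W₀.IsElliptic) (_ : W₀.IsGloballyMinimal)
        (K : Type) (_ : Field K) (_ : NumberField K),
        Semistable W₀ ∧ GoodSS W₀ p ∧ (p = 3 → W₀.frobeniusTrace 3 = 0) ∧
        Module.finrank ℚ K = 2 ∧
        IsCoprime (NumberField.discr K) ((W₀.conductorNorm ℤ * p : ℕ) : ℤ) ∧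
        (∀ (ℓ : ℕ) [Fact ℓ.Prime], (ℓ : ℤ) ∣ NumberField.discr K → GoodOrd W₀ ℓ) ∧
        ∃ C : VariableChange ℚ, C • W₀.quadraticTwist (NumberField.discr K : ℚ) = Wd := by
  rintro ⟨W₀, _, _, K, _, _, hsst, hss, h4, -, -, -, C, hC⟩
  have hD0 : (NumberField.discr K : ℚ) ≠ 0 := by exact_mod_cast NumberField.discr_ne_zero K
  exact smallImage_not_semistable_twist p Wd hp hs
    ⟨W₀, ‹_›, ‹_›, (NumberField.discr K : ℚ), C, hD0, hsst, hss, h4, hC⟩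

/-! ### What the class IS: an irreducible image of order prime to `p` -/

omit [W.IsGloballyMinimal] in
/-- **At irreducible non-surjective image, `p ∤ #ρ̄_{E,p}(Γ_ℚ)`** (Serre 1972 Prop. 15: a subgroup of
`GL₂(𝔽_p)` of order divisible by `p` is Borel or contains `SL₂(𝔽_p)`; the determinant is onto), in
the tree's currency `Nat.card (galoisRepTorsion W p).range`. Together with `ρ̄_{E,p}(I_p)` cyclic of
order `p² − 1` at a good supersingular `p` (Serre Prop. 12) this makes the image the normaliser of a
NON-SPLIT Cartan subgroup for `p ≥ 5` — the `X_ns^+(p)` locus (prose only: no tree predicate).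
[cite: Serre1972, §2.4 Prop. 15] -/
theorem smallImage_not_dvd_card_image (hirr : Irr W p) (hs : ¬ Surj W p) :
    ¬ p ∣ Nat.card (galoisRepTorsion W p).range := by
  obtain ⟨e, Φ, he, -⟩ := exists_frame_galoisRepTorsion_rat W p
  rw [← card_map_range_galoisRepTorsion W p Φ]
  exact not_dvd_card_of_not_hasSurjectiveModNGaloisRep W p Φ e he hirr hs

/-- **Class reading**: on the domain of crux `KobayashiMainConjectureSmallImage`, `p ∤ #ρ̄_{E,p}(Γ_ℚ)`.
[cite: Serre1972, §2.4 Prop. 15 and §1.11 Prop. 12] -/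
theorem smallImage_not_dvd_card_image_of_classX7 (hp : p ≠ 2) (hX : ClassX7 W p) (hs : ¬ Surj W p) :
    ¬ p ∣ Nat.card (galoisRepTorsion W p).range :=
  smallImage_not_dvd_card_image W p (ClassX7.irr W p hp hX) hs

/-! ### Assembly: every engine of the cell's X7 table is void on item 4 -/

/-- **No engine reaches item 4 (assembly).** On the domain of crux `KobayashiMainConjectureSmallImage`
(odd `p`, `ClassX7 W p`, `ρ̄_{E,p}` not onto) ALL of the following hold at once: ¬ram (so the
Fouquet–Wan locus of `FouquetWan2021_thm51_via_kobayashi74_OPEN` / `cor54_pPart_rankZero_OPEN` is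
empty), ¬(im) (`BigIm`: BCS 2025, Kato 13.4 (3)), ¬(12.5.2) (`Kato2004.ImageContainsSL2`: Kato 17.4 (3),
Kobayashi Thm. 4.1 integral), ¬(tower surjectivity) (Kim 2022/2025/2026), ¬`Semistable` (BSTW Thm. 1.3,
CCSS Thm. C/D, JSW), and `W` is no quadratic twist of a semistable good-supersingular base curve
(BSTW's twist clause). What survives in print at such a pair: Kobayashi Thm. 4.1's RATIONAL bound
(`thm41_signedCharIdeal_divisibility.rational`), Kobayashi Thm. 1.2 (torsion), Matar–Nekovář 2019
(integral Heegner-point Kolyvagin under irreducibility ONLY — the tree's twist road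
`X7LowerHalvesOnly.lean`), and per-pair descent. [cite: Serre1972, §2.4 Prop. 15 and §5.4 Prop. 21 i)]
[cite: Kato2004Asterisque, (12.5.2) and Thm. 17.4] [cite: BurungaleCastellaSkinner2025, p. 2, hypothesis (im)] -/
theorem smallImage_no_engine (hp : p ≠ 2) (hX : ClassX7 W p) (hs : ¬ Surj W p) :
    ¬ Ram W p ∧
    (¬ ∃ (ℓ : ℕ) (_ : Fact ℓ.Prime), ℓ ≠ p ∧ W.HasMultiplicativeReductionAtPrime ℓ ∧
        ¬ W.HasSplitMultiplicativeReductionAtPrime ℓ ∧ ¬ p ∣ padicValInt ℓ W.minimalDiscriminantInt) ∧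
    ¬ BigIm W p ∧ ¬ Kato2004.ImageContainsSL2 W p ∧
    (¬ ∀ n : ℕ, W.HasSurjectiveModNGaloisRep (p ^ n : ℕ)) ∧ ¬ Semistable W ∧
    (¬ ∃ (W₀ : WeierstrassCurve ℚ) (_ : W₀.IsElliptic) (_ : W₀.IsGloballyMinimal) (d : ℚ)
        (C : VariableChange ℚ), d ≠ 0 ∧ Semistable W₀ ∧ GoodSS W₀ p ∧
        (p = 3 → W₀.frobeniusTrace 3 = 0) ∧ C • W₀.quadraticTwist d = W) ∧
    ¬ p ∣ Nat.card (galoisRepTorsion W p).range :=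
  ⟨smallImage_not_ram W p hp hX hs, smallImage_not_fwLocus W p hp hX hs,
    smallImage_not_bigIm W p hp hX hs, smallImage_not_imageContainsSL2 W p hs,
    smallImage_not_towerSurj W p hs, hX.2, smallImage_not_semistable_twist p W hp hs,
    smallImage_not_dvd_card_image_of_classX7 W p hp hX hs⟩


/-! ### What the class IS, positively: a cyclic subgroup of order `p² − 1` in the image (Serre Prop. 12) -/

/-- **At an odd prime of good supersingular reduction the image `ρ̄_{E,p}(Γ_ℚ)` contains an element of
order `p² − 1`, so `p² − 1 ∣ #ρ̄_{E,p}(Γ_ℚ)`** (Serre 1972, §1.11 Prop. 12: the inertia group at the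
place's prime acts on `E[p]` through a CYCLIC group of order `p² − 1` = a non-split Cartan subgroup; tree
theorems `isCyclic_and_card_inertia_map_of_dvd_frobeniusTrace` with the tame Kummer input
`exists_mem_inertia_smul_eq_mul_of_pow_eq`). Image-free; no class hypothesis beyond `p ∤ Δ_min`,
`p ∣ a_p`. [cite: Serre1972, §1.11 Prop. 12 c) and §1.3 Prop. 1–2] -/
theorem smallImage_sq_sub_one_dvd_card_image (hp : p ≠ 2) (hgood : W.HasGoodReductionAtPrime p)
    (hss : (p : ℤ) ∣ W.frobeniusTrace p) :
    p ^ 2 - 1 ∣ Nat.card (galoisRepTorsion W p).range := by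
  have hpP : p.Prime := Fact.out
  have hΔ : ¬ (p : ℤ) ∣ minimalDiscriminantInt W :=
    W.not_dvd_minimalDiscriminantInt_of_hasGoodReductionAtPrime' p hgood
  -- the place at `p`, a prime `𝔓` of `\bar ℤ` above it, and the tame Kummer input on `I_𝔓`
  set v : IsDedekindDomain.HeightOneSpectrum (NumberField.RingOfIntegers ℚ) :=
    Rat.HeightOneSpectrum.primesEquiv.symm ⟨p, hpP⟩ with hvdef
  have hv : (Rat.HeightOneSpectrum.primesEquiv v : ℕ) = p := by rw [hvdef, Equiv.apply_symm_apply]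
  obtain ⟨𝔓, hmem, h𝔓⟩ := exists_ideal_placeOver p hv
  have hT : ∀ π ζ : AlgebraicClosure ℚ, π ^ (p ^ 2 - 1) = p → ζ ^ (p ^ 2 - 1) = 1 →
      ∃ s ∈ 𝔓.inertia (Field.absoluteGaloisGroup ℚ), s • π = ζ * π := fun π ζ hπ hζ ↦
    exists_mem_inertia_smul_eq_mul_of_pow_eq p
      (Nat.sub_pos_of_lt (Nat.one_lt_pow two_ne_zero hpP.one_lt)) hv h𝔓 hπ hζ
  -- Serre Prop. 12: `ρ̄(I_𝔓)` is cyclic of order `p² − 1`; pick a generator `ρ̄(τ)`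
  obtain ⟨hcyc, hcard⟩ := isCyclic_and_card_inertia_map_of_dvd_frobeniusTrace p hΔ hss hp hmem hT
  set G := (𝔓.inertia (Field.absoluteGaloisGroup ℚ)).map (galoisRepTorsion W (p : ℤ)) with hGdef
  haveI := hcyc
  obtain ⟨g, hg⟩ := IsCyclic.exists_ofOrder_eq_natCard (α := G)
  obtain ⟨τ, -, hτg⟩ := Subgroup.mem_map.mp g.2
  have hordτ : orderOf (galoisRepTorsion W (p : ℤ) τ) = p ^ 2 - 1 := by
    rw [hτg, Subgroup.orderOf_coe, hg, hcard]
  -- its order divides the order of the whole image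
  rw [← hordτ]
  exact Subgroup.orderOf_dvd_natCard _ ⟨τ, rfl⟩

/-- **The two divisibility facts that locate item 4's image** (prose: = the normaliser of a NON-SPLIT
Cartan subgroup for `p ≥ 5`, by Dickson's classification — the tree has no predicate for it): on the
domain of crux `KobayashiMainConjectureSmallImage` (odd `p`, `ClassX7 W p`, `ρ̄_{E,p}` not onto) the
image `ρ̄_{E,p}(Γ_ℚ) ⊂ GL₂(𝔽_p)` has order divisible by `p² − 1` (it contains the non-split Cartan
`ρ̄(I_𝔓)`, Serre Prop. 12) and prime to `p` (Serre Prop. 15), so `#ρ̄(Γ_ℚ) = (p² − 1)·m` with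
`m ∣ p − 1`: the `X_ns^+(p)` locus (non-empty for non-CM curves exactly at `p ∈ {3, 5, 7, 11}` and,
conjecturally only, no `p ≥ 19`; empty at `p = 13, 17` — Balakrishnan–Dogra–Müller–Tuitman–Vonk).
[cite: Serre1972, §1.11 Prop. 12 c) and §2.4 Prop. 15] -/
theorem smallImage_card_image_shape (hp : p ≠ 2) (hX : ClassX7 W p) (hs : ¬ Surj W p) :
    p ^ 2 - 1 ∣ Nat.card (galoisRepTorsion W p).range ∧ ¬ p ∣ Nat.card (galoisRepTorsion W p).range :=
  ⟨smallImage_sq_sub_one_dvd_card_image W p hp hX.1.1 hX.1.2,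
    smallImage_not_dvd_card_image_of_classX7 W p hp hX hs⟩

end Summit.BirchSwinnertonDyer.BirchSwinnertonDyer.Theorems

end
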